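import Summits.CriticalPhenomena.Ising3DConformalLimit.Theses.CurrentConnectionInvariance
import Summits.CriticalPhenomena.Ising3DConformalLimit.Theorems.FKParityRobustnessFarMergingGivesU4
import Literature.Probability.LatticeModels.SourcedDoubleCurrentsSwitching
import Literature.Probability.LatticeModels.CriticalUrsellFourSign
import HarnessLib

/-!
# Skeleton (birth line) for piece 2 of the split of `NormalisedU4Nonvanishing`:
# `NonGaussianLimit` (item stmt-CriticalPhenomena-0636) ⟸ sourced double currents MERGE along
# infinitely many dilations ∧ the infinite-volume switching identity ADC21 (3.11)

Route `CurrentConnectionInvariance`, crux item stmt-CriticalPhenomena-4843; crux strategist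
planner-cstrat-stmt-CriticalPhenomena-4843-r1-0, 2026-08-17.  THIS ROUTE'S mechanism for clause (iii):
the random-current reading `U₄ = −2⟨σσ⟩⟨σσ⟩·P^{xy,zt}_{β_c}[x ↔ z]` (Aizenman 1982; ADC21 (3.11)).

* `stub_switchingInfiniteVolume` — ADC21 (3.11) on `ℤ³` at `β ≤ β_c` in infinite volume: the tree's
  NAMED FACT `freeUrsellFour_eq_sourcedDoubleCurrent 3` (finite volume PROVED:
  `connectedFour_free_box_eq`; the content is the `L → ∞` passage on the non-local event `{x ↔ z}`,
  i.e. no infinite cluster of the sourced current at `β_c`, ADS2015 / ADC21 footnote 5).  Size M–L.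
* `stub_sourcedCurrentsMergeIO` — FAR MERGING OF SOURCED DOUBLE CURRENTS: for some injective lattice
  shape `x` and `c > 0`, along infinitely many dilations `L`,
  `P^{Lx₀Lx₁, Lx₂Lx₃}_{β_c(3)}[Lx₀ ↔ Lx₂] ≥ c` (the two sourced clusters at macroscopic separation merge).
  OPEN — 3D non-triviality in percolation language (dimension count `2(2−η) − 3 > 0`; false for
  `d ≥ 4`, ADC21, and for RP long-range `α < 3/2` on `ℤ³`).  Size XL.
* `NonGaussianLimit_of` — composition, PROVED: (3.11) turns the merging bound into Aizenman's far
  merging `U₄(Lx) ≤ −2c·⟨σσ⟩⟨σσ⟩` (Griffiths I: `criticalCorr_two_nonneg`), and the landed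
  `farMergingGivesU4_proof` (item stmt-CriticalPhenomena-4471) transfers it to every non-degenerate
  pointwise scaling limit.
-/

noncomputable section

open Filter Topology Finset
open scoped symmDiff
open Literature.Probability.LatticeModels Literature.Probability.Percolation
open Summit.CriticalPhenomena.Ising3DConformalLimit.FKParityRobustnessFarMergingGivesU4 (farMergingGivesU4_proof)

namespace Summit.CriticalPhenomena.Ising3DConformalLimit.Cruxes.NormalisedU4Nonvanishing.SplitBirth

/-- STUB 1 — ADC21 (3.11) in infinite volume on `ℤ³` (named fact of the tree). -/
theorem stub_switchingInfiniteVolume : freeUrsellFour_eq_sourcedDoubleCurrent 3 := by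
  sorry

/-- STUB 2 — far merging of the sourced double currents along infinitely many dilations of an
injective lattice shape. -/
theorem stub_sourcedCurrentsMergeIO :
    ∃ x : Fin 4 → Site 3, Function.Injective x ∧ ∃ c : ℝ, 0 < c ∧ ∀ L₀ : ℕ, ∃ L : ℕ, L₀ ≤ L ∧
      c ≤ (sourcedDoubleCurrentLawInf 3 (criticalBeta 3) ({(L : ℤ) • x 0} ∆ {(L : ℤ) • x 1})
        ({(L : ℤ) • x 2} ∆ {(L : ℤ) • x 3})).real (openConn ((L : ℤ) • x 0) ((L : ℤ) • x 2)) := by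
  sorry

/-- COMPOSITION (sorry-free): the two stubs give piece 2 `NonGaussianLimit` (item
stmt-CriticalPhenomena-0636, verbatim). -/
theorem NonGaussianLimit_of
    (h1 : freeUrsellFour_eq_sourcedDoubleCurrent 3)
    (h2 : ∃ x : Fin 4 → Site 3, Function.Injective x ∧ ∃ c : ℝ, 0 < c ∧ ∀ L₀ : ℕ, ∃ L : ℕ, L₀ ≤ L ∧
      c ≤ (sourcedDoubleCurrentLawInf 3 (criticalBeta 3) ({(L : ℤ) • x 0} ∆ {(L : ℤ) • x 1})
        ({(L : ℤ) • x 2} ∆ {(L : ℤ) • x 3})).real (openConn ((L : ℤ) • x 0) ((L : ℤ) • x 2))) :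
    ∀ (ρ : ℝ → ℝ) (S : Literature.Probability.LatticeModels.CorrFamily 3), (∀ δ ∈ Set.Ioc (0:ℝ) 1, 0 < ρ δ) → Literature.Probability.LatticeModels.HasPointwiseScalingLimit (Literature.Probability.LatticeModels.criticalCorr 3) ρ S → Literature.Probability.LatticeModels.IsNondegenerateTwoPoint S → Literature.Probability.LatticeModels.HasNontrivialU4 S := by
  obtain ⟨x, hx, c, hc, hio⟩ := h2
  refine farMergingGivesU4_proof ⟨2 * c, by positivity, x, hx, fun L₀ => ?_⟩
  obtain ⟨L, hL, hcle⟩ := hio L₀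
  refine ⟨L, hL, ?_⟩
  have hid := freeUrsellFour_eq_sourcedDoubleCurrent.criticalCorr_eq h1 (le_refl 3)
    ((L : ℤ) • x 0) ((L : ℤ) • x 1) ((L : ℤ) • x 2) ((L : ℤ) • x 3)
  have hfun : (fun i => (L : ℤ) • x i) = ![(L : ℤ) • x 0, (L : ℤ) • x 1, (L : ℤ) • x 2, (L : ℤ) • x 3] := by
    funext i; fin_cases i <;> rfl
  rw [hfun, hid]
  have hG : 0 ≤ criticalCorr 3 2 ![(L : ℤ) • x 0, (L : ℤ) • x 1] * criticalCorr 3 2 ![(L : ℤ) • x 2, (L : ℤ) • x 3] :=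
    mul_nonneg (criticalCorr_two_nonneg _ _) (criticalCorr_two_nonneg _ _)
  have key := mul_le_mul_of_nonneg_left hcle hG
  linarith

/-- The skeleton concludes piece 2 from its registered stubs. -/
theorem NonGaussianLimit_of_stubs :
    ∀ (ρ : ℝ → ℝ) (S : Literature.Probability.LatticeModels.CorrFamily 3), (∀ δ ∈ Set.Ioc (0:ℝ) 1, 0 < ρ δ) → Literature.Probability.LatticeModels.HasPointwiseScalingLimit (Literature.Probability.LatticeModels.criticalCorr 3) ρ S → Literature.Probability.LatticeModels.IsNondegenerateTwoPoint S → Literature.Probability.LatticeModels.HasNontrivialU4 S :=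
  NonGaussianLimit_of stub_switchingInfiniteVolume stub_sourcedCurrentsMergeIO

end Summit.CriticalPhenomena.Ising3DConformalLimit.Cruxes.NormalisedU4Nonvanishing.SplitBirth

end
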